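import Summits.Ventures.Crystal3D.StickySpheres.TetraFan
import HarnessLib

/-!
# A rational frame on a contact triangle: coordinates for pattern refutations

Venture `Crystal3D` (cell `pub-crystal3d`, seat p2). Generic linear algebra in `ℝ³` used by the machine-generated
refutations of eight- and nine-ball contact patterns (the `(8,18)` obstruction set, `ineq/FORMAL-C9-PLAN.md`).

Three mutually touching balls `p₀, p₁, p₂` (unit DIAMETER convention) give `u = p₁ − p₀`, `v = p₂ − p₀` with
`‖u‖ = ‖v‖ = 1`, `⟪u, v⟫ = 1/2`. We adjoin a normal `w ⊥ u, v` with `‖w‖² = 3/2` (`exists_frame_normal`); in the frame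
`(u, v, w)` every vector has unique coordinates (`frame_coords`, `eq_zero_of_inner_frame`), inner products are the
rational bilinear form `a a' + b b' + (a b' + b a')/2 + (3/2) c c'` (`inner_frame`), and squared distances of points
`p₀ + (a, b, c)` are the quadratic form `frameQ` (`dist_sq_frame`). The normalisation `‖w‖² = 3/2` makes every ball of a
polytetrahedral or octahedral cluster RATIONAL in this frame (the two tetrahedral apices over `p₀p₁p₂` are
`(1/3, 1/3, ±2/3)`), so contact patterns become polynomial systems over `ℚ` in the coordinates of the remaining balls.

HONEST FRAMING: folklore linear algebra, formalised as infrastructure; nothing enumerative and nothing about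
crystallization is claimed.
-/

noncomputable section

open Real RealInnerProductSpace Module

namespace Summit.Ventures.Crystal3D

/-- The quadratic form of the frame `(u, v, w)` (`‖u‖ = ‖v‖ = 1`, `⟪u,v⟫ = 1/2`, `w ⊥ u, v`, `‖w‖² = 3/2`):
`‖a u + b v + c w‖² = a² + b² + a b + (3/2) c²`. [folklore] -/
def frameQ (a b c : ℝ) : ℝ := a ^ 2 + b ^ 2 + a * b + 3 / 2 * c ^ 2

/-- **A normal of squared length `3/2` exists.** For any two vectors `u, v` in `ℝ³` there is `w` with
`⟪u, w⟫ = ⟪v, w⟫ = 0` and `⟪w, w⟫ = 3/2`. [folklore] -/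
theorem exists_frame_normal (u v : EuclideanSpace ℝ (Fin 3)) :
    ∃ w : EuclideanSpace ℝ (Fin 3), ⟪u, w⟫ = 0 ∧ ⟪v, w⟫ = 0 ∧ ⟪w, w⟫ = 3 / 2 := by
  classical
  set K : Submodule ℝ (EuclideanSpace ℝ (Fin 3)) := Submodule.span ℝ (({u, v} : Finset _) : Set _) with hK
  have hKle : finrank ℝ K ≤ 2 := by
    calc finrank ℝ K ≤ (({u, v} : Finset (EuclideanSpace ℝ (Fin 3)))).card := finrank_span_finset_le_card _
      _ ≤ 2 := Finset.card_le_two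
  have hsum := Submodule.finrank_add_finrank_orthogonal K
  rw [finrank_euclideanSpace_fin] at hsum
  have hpos : 0 < finrank ℝ Kᗮ := by omega
  obtain ⟨z, hzK, hz0⟩ := Submodule.exists_mem_ne_zero_of_ne_bot (Submodule.one_le_finrank_iff.mp hpos)
  have huK : u ∈ K := Submodule.subset_span (by simp)
  have hvK : v ∈ K := Submodule.subset_span (by simp)
  have huz : ⟪u, z⟫ = 0 := Submodule.inner_right_of_mem_orthogonal huK hzK
  have hvz : ⟪v, z⟫ = 0 := Submodule.inner_right_of_mem_orthogonal hvK hzK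
  have hzz : 0 < ⟪z, z⟫ := by
    rw [real_inner_self_eq_norm_sq]
    have : 0 < ‖z‖ := norm_pos_iff.mpr hz0
    positivity
  set r : ℝ := Real.sqrt (3 / 2 / ⟪z, z⟫) with hr
  refine ⟨r • z, ?_, ?_, ?_⟩
  · rw [real_inner_smul_right, huz, mul_zero]
  · rw [real_inner_smul_right, hvz, mul_zero]
  · rw [real_inner_smul_left, real_inner_smul_right, ← mul_assoc, ← pow_two, hr,
      Real.sq_sqrt (by positivity)]
    field_simp

/-- The frame spans `ℝ³`: a vector orthogonal to `u, v, w` vanishes. [folklore] -/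
theorem eq_zero_of_inner_frame {u v w z : EuclideanSpace ℝ (Fin 3)} (huu : ⟪u, u⟫ = 1) (hvv : ⟪v, v⟫ = 1)
    (huv : ⟪u, v⟫ = 1 / 2) (huw : ⟪u, w⟫ = 0) (hvw : ⟪v, w⟫ = 0) (hww : ⟪w, w⟫ = 3 / 2) (hzu : ⟪u, z⟫ = 0)
    (hzv : ⟪v, z⟫ = 0) (hzw : ⟪w, z⟫ = 0) : z = 0 := by
  by_contra hz
  obtain ⟨α, β, γ, hne, hrel⟩ := exists_rel_of_orthogonal hz hzu hzv hzw
  have h1 := inner_rel_eq_zero (v := u) hrel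
  have h2 := inner_rel_eq_zero (v := v) hrel
  have h3 := inner_rel_eq_zero (v := w) hrel
  have hvu : ⟪v, u⟫ = 1 / 2 := by rw [real_inner_comm]; exact huv
  have hwu : ⟪w, u⟫ = 0 := by rw [real_inner_comm]; exact huw
  have hwv : ⟪w, v⟫ = 0 := by rw [real_inner_comm]; exact hvw
  rw [huu, hvu, hwu] at h1
  rw [huv, hvv, hwv] at h2
  rw [huw, hvw, hww] at h3
  have hα : α = 0 := by linarith
  have hβ : β = 0 := by linarith
  have hγ : γ = 0 := by linarith
  rcases hne with h | h | h
  · exact h hα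
  · exact h hβ
  · exact h hγ

/-- **Coordinates in the frame.** Every vector is `a u + b v + c w` with
`a = (4⟪x,u⟫ − 2⟪x,v⟫)/3`, `b = (4⟪x,v⟫ − 2⟪x,u⟫)/3`, `c = (2/3)⟪x,w⟫`. [folklore] -/
theorem frame_coords {u v w : EuclideanSpace ℝ (Fin 3)} (huu : ⟪u, u⟫ = 1) (hvv : ⟪v, v⟫ = 1)
    (huv : ⟪u, v⟫ = 1 / 2) (huw : ⟪u, w⟫ = 0) (hvw : ⟪v, w⟫ = 0) (hww : ⟪w, w⟫ = 3 / 2)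
    (x : EuclideanSpace ℝ (Fin 3)) : ∃ a b c : ℝ, x = a • u + b • v + c • w := by
  refine ⟨(4 * ⟪x, u⟫ - 2 * ⟪x, v⟫) / 3, (4 * ⟪x, v⟫ - 2 * ⟪x, u⟫) / 3, 2 / 3 * ⟪x, w⟫, ?_⟩
  have hxu : ⟪u, x⟫ = ⟪x, u⟫ := real_inner_comm _ _
  have hxv : ⟪v, x⟫ = ⟪x, v⟫ := real_inner_comm _ _
  have hxw : ⟪w, x⟫ = ⟪x, w⟫ := real_inner_comm _ _
  have hvu : ⟪v, u⟫ = 1 / 2 := by rw [real_inner_comm]; exact huv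
  have hwu : ⟪w, u⟫ = 0 := by rw [real_inner_comm]; exact huw
  have hwv : ⟪w, v⟫ = 0 := by rw [real_inner_comm]; exact hvw
  have hz := eq_zero_of_inner_frame huu hvv huv huw hvw hww
    (z := x - (((4 * ⟪x, u⟫ - 2 * ⟪x, v⟫) / 3) • u + ((4 * ⟪x, v⟫ - 2 * ⟪x, u⟫) / 3) • v + (2 / 3 * ⟪x, w⟫) • w))
    ?_ ?_ ?_
  · exact (sub_eq_zero.1 hz)
  · simp only [inner_sub_right, inner_add_right, real_inner_smul_right, hxu, huu, huv, huw]; ring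
  · simp only [inner_sub_right, inner_add_right, real_inner_smul_right, hxv, hvu, hvv, hvw]; ring
  · simp only [inner_sub_right, inner_add_right, real_inner_smul_right, hxw, hwu, hwv, hww]; ring

/-- **Inner products in the frame** are the rational bilinear form. [folklore] -/
theorem inner_frame {u v w : EuclideanSpace ℝ (Fin 3)} (huu : ⟪u, u⟫ = 1) (hvv : ⟪v, v⟫ = 1)
    (huv : ⟪u, v⟫ = 1 / 2) (huw : ⟪u, w⟫ = 0) (hvw : ⟪v, w⟫ = 0) (hww : ⟪w, w⟫ = 3 / 2)
    (a b c a' b' c' : ℝ) :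
    ⟪a • u + b • v + c • w, a' • u + b' • v + c' • w⟫ = a * a' + b * b' + (a * b' + b * a') / 2 + 3 / 2 * c * c' := by
  have hvu : ⟪v, u⟫ = 1 / 2 := by rw [real_inner_comm]; exact huv
  have hwu : ⟪w, u⟫ = 0 := by rw [real_inner_comm]; exact huw
  have hwv : ⟪w, v⟫ = 0 := by rw [real_inner_comm]; exact hvw
  simp only [inner_add_left, inner_add_right, real_inner_smul_left, real_inner_smul_right, huu, hvv, huv, hvu, huw,
    hvw, hwu, hwv, hww]
  ring

/-- **Squared distances in the frame.** If `x − p₀` and `y − p₀` have frame coordinates `(a,b,c)` and `(a',b',c')`,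
then `dist x y ^ 2 = frameQ (a − a') (b − b') (c − c')`. [folklore] -/
theorem dist_sq_frame {u v w p₀ x y : EuclideanSpace ℝ (Fin 3)} (huu : ⟪u, u⟫ = 1) (hvv : ⟪v, v⟫ = 1)
    (huv : ⟪u, v⟫ = 1 / 2) (huw : ⟪u, w⟫ = 0) (hvw : ⟪v, w⟫ = 0) (hww : ⟪w, w⟫ = 3 / 2) {a b c a' b' c' : ℝ}
    (hx : x - p₀ = a • u + b • v + c • w) (hy : y - p₀ = a' • u + b' • v + c' • w) :
    dist x y ^ 2 = frameQ (a - a') (b - b') (c - c') := by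
  have hxy : x - y = (a - a') • u + (b - b') • v + (c - c') • w := by
    have e : x - y = (x - p₀) - (y - p₀) := by abel
    rw [e, hx, hy]
    module
  rw [dist_eq_norm, hxy, ← real_inner_self_eq_norm_sq, inner_frame huu hvv huv huw hvw hww, frameQ]
  ring

/-- **The frame of a contact triangle.** For mutually touching `p₀, p₁, p₂` there is `w` completing
`u = p₁ − p₀`, `v = p₂ − p₀` to a frame, and then every point `x` has coordinates: `x − p₀ = a u + b v + c w`.
Packaged form used by the generated pattern files. [folklore] -/
theorem exists_triangle_frame {p₀ p₁ p₂ : EuclideanSpace ℝ (Fin 3)} (h01 : dist p₀ p₁ = 1) (h02 : dist p₀ p₂ = 1)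
    (h12 : dist p₁ p₂ = 1) :
    ∃ w : EuclideanSpace ℝ (Fin 3), ⟪p₁ - p₀, p₁ - p₀⟫ = 1 ∧ ⟪p₂ - p₀, p₂ - p₀⟫ = 1 ∧ ⟪p₁ - p₀, p₂ - p₀⟫ = 1 / 2 ∧
      ⟪p₁ - p₀, w⟫ = 0 ∧ ⟪p₂ - p₀, w⟫ = 0 ∧ ⟪w, w⟫ = 3 / 2 := by
  have g11 := inner_sub_sub_of_dist p₀ p₁ p₁
  have g22 := inner_sub_sub_of_dist p₀ p₂ p₂
  have g12 := inner_sub_sub_of_dist p₀ p₁ p₂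
  rw [dist_comm] at h01 h02
  rw [h01, h02, h12, dist_self] at *
  have huu : ⟪p₁ - p₀, p₁ - p₀⟫ = 1 := by rw [g11]; norm_num
  have hvv : ⟪p₂ - p₀, p₂ - p₀⟫ = 1 := by rw [g22]; norm_num
  have huv : ⟪p₁ - p₀, p₂ - p₀⟫ = 1 / 2 := by rw [g12]; norm_num
  obtain ⟨w, h1, h2, h3⟩ := exists_frame_normal (p₁ - p₀) (p₂ - p₀)
  exact ⟨w, huu, hvv, huv, h1, h2, h3⟩

/-- The frame form is non-negative (it is a squared norm): `frameQ a b c = (a + b/2)² + (3/4) b² + (3/2) c²`. [folklore] -/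
theorem frameQ_nonneg (a b c : ℝ) : 0 ≤ frameQ a b c := by
  unfold frameQ
  nlinarith [sq_nonneg (a + b / 2), sq_nonneg b, sq_nonneg c]

/-- The frame form is even in the normal coordinate. [folklore] -/
theorem frameQ_neg (a b c : ℝ) : frameQ a b (-c) = frameQ a b c := by
  unfold frameQ
  ring

/-- Contact in coordinates: `dist x y = 1` gives `frameQ (a − a') (b − b') (c − c') = 1`. [folklore] -/
theorem frameQ_eq_one_of_dist {u v w p₀ x y : EuclideanSpace ℝ (Fin 3)} (huu : ⟪u, u⟫ = 1) (hvv : ⟪v, v⟫ = 1)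
    (huv : ⟪u, v⟫ = 1 / 2) (huw : ⟪u, w⟫ = 0) (hvw : ⟪v, w⟫ = 0) (hww : ⟪w, w⟫ = 3 / 2) {a b c a' b' c' : ℝ}
    (hx : x - p₀ = a • u + b • v + c • w) (hy : y - p₀ = a' • u + b' • v + c' • w) (h : dist x y = 1) :
    frameQ (a - a') (b - b') (c - c') = 1 := by
  rw [← dist_sq_frame huu hvv huv huw hvw hww hx hy, h, one_pow]

/-- Non-overlap in coordinates: `1 ≤ dist x y` gives `1 ≤ frameQ (a − a') (b − b') (c − c')`. [folklore] -/
theorem one_le_frameQ_of_dist {u v w p₀ x y : EuclideanSpace ℝ (Fin 3)} (huu : ⟪u, u⟫ = 1) (hvv : ⟪v, v⟫ = 1)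
    (huv : ⟪u, v⟫ = 1 / 2) (huw : ⟪u, w⟫ = 0) (hvw : ⟪v, w⟫ = 0) (hww : ⟪w, w⟫ = 3 / 2) {a b c a' b' c' : ℝ}
    (hx : x - p₀ = a • u + b • v + c • w) (hy : y - p₀ = a' • u + b' • v + c' • w) (h : 1 ≤ dist x y) :
    1 ≤ frameQ (a - a') (b - b') (c - c') := by
  rw [← dist_sq_frame huu hvv huv huw hvw hww hx hy]
  nlinarith [h]

/-- **Coordinates with a sign condition.** If `0 ≤ ⟪x, w⟫` the normal coordinate can be taken `≥ 0`. [folklore] -/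
theorem frame_coords_nonneg {u v w : EuclideanSpace ℝ (Fin 3)} (huu : ⟪u, u⟫ = 1) (hvv : ⟪v, v⟫ = 1)
    (huv : ⟪u, v⟫ = 1 / 2) (huw : ⟪u, w⟫ = 0) (hvw : ⟪v, w⟫ = 0) (hww : ⟪w, w⟫ = 3 / 2)
    {x : EuclideanSpace ℝ (Fin 3)} (hxw : 0 ≤ ⟪x, w⟫) : ∃ a b c : ℝ, 0 ≤ c ∧ x = a • u + b • v + c • w := by
  obtain ⟨a, b, c, hx⟩ := frame_coords huu hvv huv huw hvw hww x
  refine ⟨a, b, c, ?_, hx⟩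
  have e : ⟪x, w⟫ = 3 / 2 * c := by
    rw [hx]
    simp only [inner_add_left, real_inner_smul_left, huw, hvw, hww]
    ring
  rw [e] at hxw
  linarith

/-- **The frame of a contact triangle, oriented towards a given point.** As `exists_triangle_frame`, with the normal `w`
chosen so that `0 ≤ ⟪x − p₀, w⟫` for a prescribed point `x` (replace `w` by `−w` if necessary). [folklore] -/
theorem exists_triangle_frame_towards {p₀ p₁ p₂ : EuclideanSpace ℝ (Fin 3)} (h01 : dist p₀ p₁ = 1)
    (h02 : dist p₀ p₂ = 1) (h12 : dist p₁ p₂ = 1) (x : EuclideanSpace ℝ (Fin 3)) :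
    ∃ w : EuclideanSpace ℝ (Fin 3), ⟪p₁ - p₀, p₁ - p₀⟫ = 1 ∧ ⟪p₂ - p₀, p₂ - p₀⟫ = 1 ∧ ⟪p₁ - p₀, p₂ - p₀⟫ = 1 / 2 ∧
      ⟪p₁ - p₀, w⟫ = 0 ∧ ⟪p₂ - p₀, w⟫ = 0 ∧ ⟪w, w⟫ = 3 / 2 ∧ 0 ≤ ⟪x - p₀, w⟫ := by
  obtain ⟨w, huu, hvv, huv, h1, h2, h3⟩ := exists_triangle_frame h01 h02 h12
  by_cases hs : 0 ≤ ⟪x - p₀, w⟫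
  · exact ⟨w, huu, hvv, huv, h1, h2, h3, hs⟩
  · refine ⟨-w, huu, hvv, huv, ?_, ?_, ?_, ?_⟩
    · rw [inner_neg_right, h1, neg_zero]
    · rw [inner_neg_right, h2, neg_zero]
    · rw [inner_neg_left, inner_neg_right, neg_neg, h3]
    · rw [inner_neg_right]; linarith

end Summit.Ventures.Crystal3D

end
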